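import Literature.Topology.FourManifolds.AndrewsCurtisCertificate

/-!
# Bowman–McCaul 2006: the printed Andrews–Curtis trivialisation of a length-14 Gordon presentation

R. S. Bowman and S. B. McCaul, *Fast searching for Andrews–Curtis trivializations*, Experiment. Math. 15 (2006)
193–197, print on p. 196 an explicit trivialisation of `⟨a, b ∣ a b a⁻² b⁻¹, a b³ a⁻¹ b⁻⁴⟩` — a member of the
Gordon family `⟨a, b ∣ a = [aᵐ, bⁿ], b = [aᵖ, bᑫ]⟩` of total relator length 14 (they report that all ten
length-14 members are AC-trivialisable; this one needed disk-based breadth-first search and "20 moves").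
This file REPRODUCES that published trivialisation as a kernel-replayed certificate.  The 17 printed lines are
displayed in the paper's cyclic-permutation canonical form; where a printed step multiplies by a conjugate of the
displayed relator (e.g. step 3 uses `b r₀ b⁻¹`) the conjugation is made explicit, so the move list below has
56 elementary moves (`rᵢ ↦ rᵢ⁻¹`, `rᵢ ↦ rᵢ rⱼ`, `rᵢ ↦ xₖ^{±1} rᵢ xₖ^{∓1}`) with total relator length never above 19,
and ends at the literal trivial presentation.  The words are the paper's (`a = x₀`, `b = x₁`); the same move
list is accepted by two independent Python replayers of the SP4 standardness census before the kernel.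

## Sources
* R. S. Bowman, S. B. McCaul, *Fast searching for Andrews–Curtis trivializations*, Experiment. Math. 15 (2006)
  193–197, doi:10.1080/10586458.2006.10128962, p. 196. [BowmanMcCaul2006]
* C. McA. Gordon's presentations, via R. Brown, *Coproducts of crossed P-modules …*, Topology 23 (1984) 337–345. [Brown1984]
-/

namespace Literature.Topology.FourManifolds

namespace ACRecords

/-- Bowman–McCaul 2006 p. 196: the Gordon-family presentation `⟨a, b ∣ a b a⁻² b⁻¹, a b³ a⁻¹ b⁻⁴⟩` as words
(`a = x₀`, `b = x₁`), relators as printed. [cite: BowmanMcCaul2006, p. 196] -/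
def bowmanMcCaul2006p196_start : ACCert.WPres 2 := ![[(0, true), (1, true), (0, false), (0, false), (1, false)], [(0, true), (1, true), (1, true), (1, true), (0, false), (1, false), (1, false), (1, false), (1, false)]]

/-- The printed trivialisation (17 displayed steps, "20 moves") expanded to 56 elementary moves; the expansion makes the
conjugations hidden by the paper's cyclic canonical form explicit.  Max total relator length along the path: 19. [cite: BowmanMcCaul2006, p. 196] -/
def bowmanMcCaul2006p196_moves : List (ACCert.Step 2) :=
  [.inv 0, .conj 0 1, .conjInv 0 1, .conj 0 1, .mul 1 0, .conjInv 0 1, .mul 1 0, .conjInv 1 0,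
    .conjInv 1 1, .conj 1 0, .mul 1 0, .conjInv 1 0, .conjInv 1 1, .conj 1 0, .mul 1 0,
    .conjInv 1 0, .conjInv 1 1, .conj 1 0, .conj 1 1, .conj 1 1, .mul 1 0, .conjInv 1 0, .mul 1 0,
    .conjInv 1 0, .mul 1 0, .conjInv 1 0, .conjInv 1 1, .conjInv 1 0, .conj 1 1, .mul 0 1,
    .conjInv 0 1, .inv 0, .conjInv 1 1, .conj 1 0, .mul 1 0, .inv 1, .mul 0 1, .mul 0 1, .conj 0 0,
    .mul 0 1, .conj 0 0, .mul 0 1, .conj 0 0, .mul 0 1, .conj 0 0, .mul 0 1, .conj 0 0, .mul 0 1,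
    .conj 0 0, .mul 0 1, .mul 0 1, .inv 0, .mul 1 0, .inv 1, .mul 0 1, .inv 0]

/-- BOWMAN–McCAUL 2006, p. 196 (reproduced): `⟨a, b ∣ a b a⁻² b⁻¹, a b³ a⁻¹ b⁻⁴⟩` is Andrews–Curtis trivial; kernel replay of the
published move sequence. [cite: BowmanMcCaul2006, p. 196] -/
theorem bowmanMcCaul2006p196_acTrivial :
    IsAndrewsCurtisEquivalent (ACCert.toPres bowmanMcCaul2006p196_start) (BalancedPresentation.trivial 2) :=
  ACCert.certify (P := bowmanMcCaul2006p196_start) rfl bowmanMcCaul2006p196_moves (by decide +kernel)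

end ACRecords

end Literature.Topology.FourManifolds
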